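import Summits.Ventures.CertifiedArithmetic.LowPrec.CompensatedSum
import Summits.Ventures.CertifiedArithmetic.LowPrec.TwoSum

/-!
# Compensated summation with ANY error-free correction step; the branch-free `Sum2` (cascaded 2Sum)

HONEST FRAMING (venture CertifiedArithmetic / cell `pub-lowprec`): certified error envelopes and
provably optimal rounding/accumulation schemes for low-precision formats under stated cost models;
every table by two implementations; no hardware or vendor claims.

`CompensatedSum.lean` proved the envelope `|res - s| ≤ u|s| + n(n-1)u²·Σ|xᵢ|` for Neumaier's
branch variant (`kbn`). The argument used only that each correction equals the local rounding error.
Here the scheme is made GENERIC in the correction step `corr : ℚ → ℚ → ℚ` (`compSum`): if `corr` is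
an error-free transformation of addition on the values of `α` — `corr a b = a + b - fl(a + b)` — then
the same envelope holds (`abs_compSum_sub_sum_le`, every `α` with `emaxCode ≥ 2`, summands in `F_α`,
chain sums in range). Instances: (1) the BRANCH-FREE cascaded-2Sum summation (`Sum2` of
[OgitaRumpOishi2005]; [BoldoEtAl2023, §5.3]) — its correction step is an EFT in every format with
no range hypothesis by `twoSum_exact` (`TwoSum.lean`), so `abs_sum2_sub_sum_le`; (2) Neumaier's `kbn`
is `compSum` with the branch-Fast2Sum step (`kbn_eq_compSum`). The second-order `γₙ²` form of the
literature follows as in `CompensatedSum.lean`.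
-/

namespace Literature.ComputerArithmetic.FloatingPoint

namespace MiniFloat

open Finset
open Literature.ComputerArithmetic.JeannerodRump2018
open Literature.ComputerArithmetic.JeannerodRump2018.SumTree

variable {α : Format}

/-! ### The generic scheme -/

/-- Compensated recursive summation in format `α` with correction step `corr`: `ŝ₀ = fl(x₀)`,
`c₀ = 0`, `ŝₖ₊₁ = fl(ŝₖ + xₖ₊₁)`, `cₖ₊₁ = fl(cₖ + corr ŝₖ xₖ₊₁)`; the pair `(ŝₖ, cₖ)`.
[cite: OgitaRumpOishi2005, Algorithm Sum2 (cascaded compensated summation)] -/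
def compSum (α : Format) (corr : ℚ → ℚ → ℚ) (x : ℕ → ℚ) : ℕ → ℚ × ℚ
  | 0 => (flα α (x 0), 0)
  | k + 1 => (flα α ((compSum α corr x k).1 + x (k + 1)),
      flα α ((compSum α corr x k).2 + corr (compSum α corr x k).1 (x (k + 1))))

/-- The delivered result `res = fl(ŝₙ + cₙ)`. [cite: OgitaRumpOishi2005, Algorithm Sum2] -/
def compSumRes (α : Format) (corr : ℚ → ℚ → ℚ) (x : ℕ → ℚ) (n : ℕ) : ℚ :=
  flα α ((compSum α corr x n).1 + (compSum α corr x n).2)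

/-- The 2Sum correction step as a function of the two operand values (five roundings after `s`).
[cite: BoldoMelquiond2017, Thm 5.7 (Algorithm 5.2)] -/
def twoSumCorr (α : Format) (a b : ℚ) : ℚ :=
  flα α (flα α (a - flα α (flα α (a + b) - b))
    + flα α (b - flα α (flα α (a + b) - flα α (flα α (a + b) - b))))

/-- Neumaier's branch correction step as a function of the operand values.
[cite: BoldoEtAl2023, §5.3 (Neumaier1974)] -/
def kbnCorrFn (α : Format) (a b : ℚ) : ℚ :=
  if |b| ≤ |a| then flα α (flα α (a - flα α (a + b)) + b) else flα α (flα α (b - flα α (a + b)) + a)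

/-- Step equation. [folklore] -/
theorem compSum_succ (corr : ℚ → ℚ → ℚ) (x : ℕ → ℚ) (k : ℕ) : compSum α corr x (k + 1)
    = (flα α ((compSum α corr x k).1 + x (k + 1)),
       flα α ((compSum α corr x k).2 + corr (compSum α corr x k).1 (x (k + 1)))) := rfl

/-- The running sum is a value. [folklore] -/
theorem exists_toRat_eq_compSum_fst (corr : ℚ → ℚ → ℚ) (x : ℕ → ℚ) :
    ∀ k, ∃ y : MiniFloat α, y.toRat = (compSum α corr x k).1
  | 0 => ⟨roundNE α (x 0), rfl⟩
  | _ + 1 => ⟨roundNE α _, rfl⟩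

/-- The running compensation is a value. [folklore] -/
theorem exists_toRat_eq_compSum_snd (corr : ℚ → ℚ → ℚ) (x : ℕ → ℚ) :
    ∀ k, ∃ y : MiniFloat α, y.toRat = (compSum α corr x k).2
  | 0 => ⟨zero α, by simp [compSum]⟩
  | _ + 1 => ⟨roundNE α _, rfl⟩

/-- 2SUM STEP IS AN EFT (every format, no range hypothesis): `twoSumCorr α a b = a + b - fl(a + b)` for
values `a, b`. [cite: BoldoMelquiond2017, Thm 5.7 (saturating form: TwoSum.lean)] -/
theorem twoSumCorr_eq (a b : MiniFloat α) :
    twoSumCorr α a.toRat b.toRat = a.toRat + b.toRat - flα α (a.toRat + b.toRat) := by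
  unfold twoSumCorr flα
  exact twoSum_exact a b

/-- Neumaier's step is an EFT (every format, no range hypothesis). [cite: BoldoMelquiond2017, Thm 5.6] -/
theorem kbnCorrFn_eq (a b : MiniFloat α) :
    kbnCorrFn α a.toRat b.toRat = a.toRat + b.toRat - flα α (a.toRat + b.toRat) := by
  unfold kbnCorrFn flα
  split
  · rename_i h; exact fast2Sum_exact' a b h
  · rename_i h
    have := fast2Sum_exact' b a (not_le.mp h).le
    rw [add_comm b.toRat a.toRat] at this
    exact this

/-- Neumaier's `kbn` is the generic scheme with the branch step. [folklore] -/
theorem kbn_eq_compSum (x : ℕ → ℚ) : ∀ k, kbn α x k = compSum α (kbnCorrFn α) x k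
  | 0 => rfl
  | k + 1 => by
      rw [kbn_succ, compSum_succ, ← kbn_eq_compSum x k]
      unfold kbnCorr kbnCorrFn
      rfl

/-! ### The envelope for any EFT correction step -/

section Generic

variable (corr : ℚ → ℚ → ℚ)
  (hcorr : ∀ a b : MiniFloat α, corr a.toRat b.toRat = a.toRat + b.toRat - flα α (a.toRat + b.toRat))
include hcorr

/-- With an EFT step and `xₖ₊₁ ∈ F_α`, the correction IS the local error `ŝₖ + xₖ₊₁ - ŝₖ₊₁`.
[folklore] -/
theorem compSum_corr_eq (x : ℕ → ℚ) (k : ℕ) (hxk : ∃ y : MiniFloat α, y.toRat = x (k + 1)) :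
    corr (compSum α corr x k).1 (x (k + 1))
      = (compSum α corr x k).1 + x (k + 1) - (compSum α corr x (k + 1)).1 := by
  obtain ⟨a, ha⟩ := exists_toRat_eq_compSum_fst (α := α) corr x k
  obtain ⟨b, hb⟩ := hxk
  rw [compSum_succ, ← ha, ← hb]
  exact hcorr a b

/-- Each correction is a value of `α`. [folklore] -/
theorem exists_toRat_eq_compSum_corr (x : ℕ → ℚ) (k : ℕ)
    (hxk : ∃ y : MiniFloat α, y.toRat = x (k + 1)) :
    ∃ y : MiniFloat α, y.toRat = corr (compSum α corr x k).1 (x (k + 1)) := by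
  obtain ⟨a, ha⟩ := exists_toRat_eq_compSum_fst (α := α) corr x k
  obtain ⟨b, hb⟩ := hxk
  obtain ⟨e, he⟩ := addErr_representable a b
  refine ⟨e, ?_⟩
  rw [← ha, ← hb, hcorr a b, he, flα]

/-- Telescoping: `ŝₙ + Σ_{k<n} eₖ₊₁ = Σ_{i≤n} xᵢ`. [folklore] -/
theorem compSum_fst_add_sum_corr (x : ℕ → ℚ) :
    ∀ n, (∀ i ≤ n, ∃ y : MiniFloat α, y.toRat = x i) →
      (compSum α corr x n).1 + ∑ k ∈ range n, corr (compSum α corr x k).1 (x (k + 1))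
        = ∑ i ∈ range (n + 1), x i
  | 0, hx => by
      simp only [compSum, range_zero, sum_empty, add_zero, zero_add, range_one, sum_singleton]
      exact toRat_roundNE_of_exists (hx 0 le_rfl)
  | n + 1, hx => by
      have ih := compSum_fst_add_sum_corr x n (fun i hi => hx i (Nat.le_succ_of_le hi))
      rw [sum_range_succ, sum_range_succ (fun i => x i), ← ih,
        compSum_corr_eq corr hcorr x n (hx (n + 1) le_rfl)]
      ring

omit hcorr in
/-- The main chain is the comb over the summands. [folklore] -/
theorem eval_combTree_eq_compSum_fst (x : ℕ → ℚ) (h0 : ∃ y : MiniFloat α, y.toRat = x 0) :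
    ∀ k, SumTree.eval (flα α) (combTree x k) = (compSum α corr x k).1
  | 0 => by simp only [combTree, SumTree.eval, compSum]; exact (toRat_roundNE_of_exists h0).symm
  | k + 1 => by
      rw [combTree, SumTree.eval, eval_combTree_eq_compSum_fst x h0 k, compSum_succ]
      rfl

/-- The local errors of the main chain are the corrections. [folklore] -/
theorem absErr_combTree_eq_compSum (x : ℕ → ℚ) :
    ∀ n, (∀ i ≤ n, ∃ y : MiniFloat α, y.toRat = x i) →
      absErr (flα α) (combTree x n) = ∑ k ∈ range n, |corr (compSum α corr x k).1 (x (k + 1))|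
  | 0, _ => by simp [absErr, SumTree.localErrors, combTree]
  | n + 1, hx => by
      have hx' : ∀ i ≤ n, ∃ y : MiniFloat α, y.toRat = x i := fun i hi => hx i (Nat.le_succ_of_le hi)
      rw [combTree, absErr_node, absErr_combTree_eq_compSum x n hx', sum_range_succ,
        eval_combTree_eq_compSum_fst corr x (hx 0 (Nat.zero_le _)) n,
        compSum_corr_eq corr hcorr x n (hx (n + 1) le_rfl), compSum_succ]
      simp only [SumTree.eval, absErr, SumTree.localErrors, List.map_nil, List.sum_nil, add_zero]
      rw [abs_sub_comm]

/-- The compensation chain is the comb over the corrections: `eval = cₙ₊₁`. [folklore] -/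
theorem eval_combTree_eq_compSum_snd (x : ℕ → ℚ) (hx1 : ∃ y : MiniFloat α, y.toRat = x 1) :
    ∀ n, SumTree.eval (flα α) (combTree (fun k => corr (compSum α corr x k).1 (x (k + 1))) n)
      = (compSum α corr x (n + 1)).2
  | 0 => by
      simp only [combTree, SumTree.eval, compSum, zero_add]
      exact (toRat_roundNE_of_exists (exists_toRat_eq_compSum_corr corr hcorr x 0 hx1)).symm
  | n + 1 => by
      rw [combTree, SumTree.eval, eval_combTree_eq_compSum_snd x hx1 n, compSum_succ corr x (n + 1)]
      rfl

/-- (iii) `Σ|eₖ₊₁| ≤ n·u/(1+u)·Σ|xᵢ|` on the main chain. [cite: JeannerodRump2018, Thm 4.1] -/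
theorem sum_abs_compSum_corr_le (hα : 2 ≤ α.emaxCode) (x : ℕ → ℚ) (n : ℕ)
    (hx : ∀ i ≤ n, ∃ y : MiniFloat α, y.toRat = x i)
    (hr : ∀ k < n, |(compSum α corr x k).1 + x (k + 1)| ≤ α.maxRat) :
    ∑ k ∈ range n, |corr (compSum α corr x k).1 (x (k + 1))|
      ≤ n * (α.unitRoundoff / (1 + α.unitRoundoff)) * ∑ i ∈ range (n + 1), |x i| := by
  have hrange : ∀ k ≤ n, TreeInRange α (combTree x k) := by
    intro k hk
    induction k with
    | zero => exact hx 0 (Nat.zero_le _)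
    | succ j ih =>
        refine ⟨ih (Nat.le_of_succ_le hk), hx (j + 1) hk, ?_⟩
        rw [eval_combTree_eq_compSum_fst corr x (hx 0 (Nat.zero_le _)) j]
        exact hr j (Nat.lt_of_succ_le hk)
  have h := absErr_flα_le hα (combTree x n) (hrange n le_rfl)
  rw [absErr_combTree_eq_compSum corr hcorr x n hx, absSum_combTree, length_leaves_combTree] at h
  push_cast at h
  simpa using h

/-- (iv) `|cₙ - Σ eₖ₊₁| ≤ (n-1)·u/(1+u)·Σ|eₖ₊₁|` on the compensation chain. [cite: JeannerodRump2018, Thm 4.1] -/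
theorem abs_compSum_snd_sub_sum_corr_le (hα : 2 ≤ α.emaxCode) (x : ℕ → ℚ) (n : ℕ)
    (hx : ∀ i ≤ n, ∃ y : MiniFloat α, y.toRat = x i)
    (hr : ∀ k < n, |(compSum α corr x k).2 + corr (compSum α corr x k).1 (x (k + 1))| ≤ α.maxRat) :
    |(compSum α corr x n).2 - ∑ k ∈ range n, corr (compSum α corr x k).1 (x (k + 1))|
      ≤ ((n : ℚ) - 1) * (α.unitRoundoff / (1 + α.unitRoundoff))
        * ∑ k ∈ range n, |corr (compSum α corr x k).1 (x (k + 1))| := by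
  cases n with
  | zero => simp [compSum]
  | succ m =>
      have hx1 : ∃ y : MiniFloat α, y.toRat = x 1 := hx 1 (by omega)
      have hrange : ∀ k ≤ m,
          TreeInRange α (combTree (fun k => corr (compSum α corr x k).1 (x (k + 1))) k) := by
        intro k hk
        induction k with
        | zero => exact exists_toRat_eq_compSum_corr corr hcorr x 0 hx1
        | succ j ih =>
            refine ⟨ih (Nat.le_of_succ_le hk),
              exists_toRat_eq_compSum_corr corr hcorr x (j + 1) (hx (j + 2) (by omega)), ?_⟩
            rw [eval_combTree_eq_compSum_snd corr hcorr x hx1 j]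
            exact hr (j + 1) (by omega)
      have h := abs_eval_sub_exact_le_sharp hα _ (hrange m le_rfl)
      rw [eval_combTree_eq_compSum_snd corr hcorr x hx1 m, exact_combTree, absSum_combTree,
        length_leaves_combTree] at h
      push_cast at h
      simpa using h

/-- GENERIC ENVELOPE: for ANY error-free correction step, summands `x₀ … xₙ ∈ F_α` (`emaxCode ≥ 2`)
and no chain sum out of range, `|res - Σxᵢ| ≤ u·|Σxᵢ| + n(n-1)·u²·Σ|xᵢ|`.
[cite: OgitaRumpOishi2005, Sum2 error bound shape (u|s| + γ²·Σ|xᵢ|)] -/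
theorem abs_compSum_sub_sum_le (hα : 2 ≤ α.emaxCode) (x : ℕ → ℚ) (n : ℕ)
    (hx : ∀ i ≤ n, ∃ y : MiniFloat α, y.toRat = x i)
    (hr1 : ∀ k < n, |(compSum α corr x k).1 + x (k + 1)| ≤ α.maxRat)
    (hr2 : ∀ k < n, |(compSum α corr x k).2 + corr (compSum α corr x k).1 (x (k + 1))| ≤ α.maxRat)
    (hr3 : |(compSum α corr x n).1 + (compSum α corr x n).2| ≤ α.maxRat) :
    |compSumRes α corr x n - ∑ i ∈ range (n + 1), x i|
      ≤ α.unitRoundoff * |∑ i ∈ range (n + 1), x i|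
        + ((n : ℚ) * (n - 1)) * α.unitRoundoff ^ 2 * ∑ i ∈ range (n + 1), |x i| := by
  set u := α.unitRoundoff with hu_def
  set u' := u / (1 + u) with hu'
  have hupos : 0 < u := α.unitRoundoff_pos
  have hu'0 : 0 ≤ u' := div_nonneg hupos.le (by linarith)
  set s := ∑ i ∈ range (n + 1), x i with hs
  set L := ∑ i ∈ range (n + 1), |x i| with hL
  set E := ∑ k ∈ range n, corr (compSum α corr x k).1 (x (k + 1)) with hE
  set Eabs := ∑ k ∈ range n, |corr (compSum α corr x k).1 (x (k + 1))| with hEabs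
  have hL0 : 0 ≤ L := sum_nonneg fun _ _ => abs_nonneg _
  have h2 : (compSum α corr x n).1 + E = s := compSum_fst_add_sum_corr corr hcorr x n hx
  have h3 : Eabs ≤ n * u' * L := sum_abs_compSum_corr_le corr hcorr hα x n hx hr1
  have h4 : |(compSum α corr x n).2 - E| ≤ ((n : ℚ) - 1) * u' * Eabs :=
    abs_compSum_snd_sub_sum_corr_le corr hcorr hα x n hx hr2
  obtain ⟨ys, hys⟩ := exists_toRat_eq_compSum_fst (α := α) corr x n
  obtain ⟨yc, hyc⟩ := exists_toRat_eq_compSum_snd (α := α) corr x n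
  have h5 : |compSumRes α corr x n - ((compSum α corr x n).1 + (compSum α corr x n).2)|
      ≤ u' * |(compSum α corr x n).1 + (compSum α corr x n).2| := by
    have := abs_err_roundNE_add_le_sharp hα ys yc (by rw [hys, hyc]; exact hr3)
    rw [hys, hyc] at this
    exact this
  set D := (compSum α corr x n).2 - E with hD
  have hDle : |D| ≤ ((n : ℚ) * (n - 1)) * u' ^ 2 * L := by
    rcases Nat.eq_zero_or_pos n with hn | hn
    · subst hn; simp [hD, hE, compSum]
    · have hn1 : (1 : ℚ) ≤ n := by exact_mod_cast hn
      calc |D| ≤ ((n : ℚ) - 1) * u' * Eabs := h4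
        _ ≤ ((n : ℚ) - 1) * u' * (n * u' * L) :=
            mul_le_mul_of_nonneg_left h3 (mul_nonneg (by linarith) hu'0)
        _ = ((n : ℚ) * (n - 1)) * u' ^ 2 * L := by ring
  have hsum : (compSum α corr x n).1 + (compSum α corr x n).2 = s + D := by rw [hD, ← h2]; ring
  rw [hsum] at h5
  -- sharp form first
  have hsharp : |compSumRes α corr x n - s| ≤ u' * |s| + (1 + u') * ((n : ℚ) * (n - 1)) * u' ^ 2 * L := by
    have hkey : compSumRes α corr x n - s = (compSumRes α corr x n - (s + D)) + D := by ring
    rw [hkey]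
    calc |compSumRes α corr x n - (s + D) + D| ≤ |compSumRes α corr x n - (s + D)| + |D| :=
          abs_add_le _ _
      _ ≤ u' * |s + D| + |D| := by linarith
      _ ≤ u' * (|s| + |D|) + |D| := by linarith [mul_le_mul_of_nonneg_left (abs_add_le s D) hu'0]
      _ = u' * |s| + (1 + u') * |D| := by ring
      _ ≤ u' * |s| + (1 + u') * (((n : ℚ) * (n - 1)) * u' ^ 2 * L) := by
          have : 0 ≤ 1 + u' := by linarith
          nlinarith
      _ = u' * |s| + (1 + u') * ((n : ℚ) * (n - 1)) * u' ^ 2 * L := by ring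
  -- relax u' ≤ u and (1+u')u'² ≤ u²
  have hS0 := abs_nonneg s
  have h1 : u' ≤ u := by rw [hu', div_le_iff₀ (by linarith)]; nlinarith
  have h6 := one_add_mul_sq_sharp_le u hupos.le
  have hnn : (0 : ℚ) ≤ (n : ℚ) * (n - 1) := by
    rcases Nat.eq_zero_or_pos n with hn | hn
    · subst hn; simp
    · have : (1 : ℚ) ≤ n := by exact_mod_cast hn
      nlinarith
  refine le_trans hsharp ?_
  have e : (1 + u') * ((n : ℚ) * (n - 1)) * u' ^ 2 * L
      = ((n : ℚ) * (n - 1)) * ((1 + u / (1 + u)) * (u / (1 + u)) ^ 2) * L := by rw [hu']; ring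
  rw [e]
  apply add_le_add
  · exact mul_le_mul_of_nonneg_right h1 hS0
  · exact mul_le_mul_of_nonneg_right (mul_le_mul_of_nonneg_left h6 hnn) hL0

end Generic

/-! ### Instances -/

/-- `SUM2` (BRANCH-FREE CASCADED 2SUM SUMMATION) IN A MINIFLOAT FORMAT: for summands
`x₀ … xₙ ∈ F_α` (`emaxCode ≥ 2`) and no chain sum out of range,
`|res - Σxᵢ| ≤ u·|Σxᵢ| + n(n-1)·u²·Σ|xᵢ|`; the 2Sum corrections themselves need no range hypothesis
(`twoSum_exact`). [cite: OgitaRumpOishi2005, Algorithm Sum2 and its error bound] -/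
theorem abs_sum2_sub_sum_le (hα : 2 ≤ α.emaxCode) (x : ℕ → ℚ) (n : ℕ)
    (hx : ∀ i ≤ n, ∃ y : MiniFloat α, y.toRat = x i)
    (hr1 : ∀ k < n, |(compSum α (twoSumCorr α) x k).1 + x (k + 1)| ≤ α.maxRat)
    (hr2 : ∀ k < n, |(compSum α (twoSumCorr α) x k).2
      + twoSumCorr α (compSum α (twoSumCorr α) x k).1 (x (k + 1))| ≤ α.maxRat)
    (hr3 : |(compSum α (twoSumCorr α) x n).1 + (compSum α (twoSumCorr α) x n).2| ≤ α.maxRat) :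
    |compSumRes α (twoSumCorr α) x n - ∑ i ∈ range (n + 1), x i|
      ≤ α.unitRoundoff * |∑ i ∈ range (n + 1), x i|
        + ((n : ℚ) * (n - 1)) * α.unitRoundoff ^ 2 * ∑ i ∈ range (n + 1), |x i| :=
  abs_compSum_sub_sum_le (twoSumCorr α) twoSumCorr_eq hα x n hx hr1 hr2 hr3

/-- The same envelope for the IDEAL scheme whose correction is the exact local error (any EFT
implementation agrees with it on values). [folklore] -/
theorem abs_compSum_exact_sub_sum_le (hα : 2 ≤ α.emaxCode) (x : ℕ → ℚ) (n : ℕ)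
    (hx : ∀ i ≤ n, ∃ y : MiniFloat α, y.toRat = x i)
    (hr1 : ∀ k < n, |(compSum α (fun a b => a + b - flα α (a + b)) x k).1 + x (k + 1)| ≤ α.maxRat)
    (hr2 : ∀ k < n, |(compSum α (fun a b => a + b - flα α (a + b)) x k).2
      + ((compSum α (fun a b => a + b - flα α (a + b)) x k).1 + x (k + 1)
        - flα α ((compSum α (fun a b => a + b - flα α (a + b)) x k).1 + x (k + 1)))| ≤ α.maxRat)
    (hr3 : |(compSum α (fun a b => a + b - flα α (a + b)) x n).1
      + (compSum α (fun a b => a + b - flα α (a + b)) x n).2| ≤ α.maxRat) :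
    |compSumRes α (fun a b => a + b - flα α (a + b)) x n - ∑ i ∈ range (n + 1), x i|
      ≤ α.unitRoundoff * |∑ i ∈ range (n + 1), x i|
        + ((n : ℚ) * (n - 1)) * α.unitRoundoff ^ 2 * ∑ i ∈ range (n + 1), |x i| :=
  abs_compSum_sub_sum_le (fun a b => a + b - flα α (a + b)) (fun _ _ => rfl) hα x n hx hr1 hr2 hr3

/-- Kernel illustration (bfloat16, `u = 2^-8`, summands `1, u, u, u, u`): the branch-free Sum2 also
returns the exact sum `1 + 1/64` (recursive summation: `1`). [folklore] -/
theorem sum2_BFloat16_witness :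
    compSumRes Format.BFloat16 (twoSumCorr Format.BFloat16) (fun i => if i = 0 then 1 else 1 / 256) 4
      = 1 + 1 / 64 := by
  decide +kernel

end MiniFloat

end Literature.ComputerArithmetic.FloatingPoint
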